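import Mathlib.AlgebraicGeometry.EllipticCurve.Weierstrass
import HarnessLib

/-!
# BirchSwinnertonDyer — rank-2 `Ш[p^∞]` cell: KERNEL-POLYNOMIAL CERTIFICATE of a rational
# `p`-isogeny (`E[p]` reducible) for odd `p`, decided in the kernel

HONEST FRAMING (cell `b2b-bsdr2sha`, run/shared/lean/b2b/bsd-rank2-sha/, ENGINE 3 = IMC
bookkeeping): per-pair certified theorems «cited hypotheses ∧ certified computation ⇒ `Ш(E/ℚ)[p^∞]`
finite of order `p^k`»; NO claim on BSD in rank `≥ 2`. This file decides ONE hypothesis of the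
reducible (Eisenstein) rows — `hred : ¬ E[p] irreducible`, the binder of the tree's Wuthrich-2014
adapter `padicBSD_inequality_of_wuthrich16_odd_of_coeff_ne_zero_of_optimal` — from a KERNEL
POLYNOMIAL, for the cells (`p = 5, 7, 13` in the census) where `E(ℚ)` has no point of order `p` and
the division polynomial has no rational root (so neither the Mazur-torsion route nor the `Ψ₃`-root
route of `EisensteinKernelCertificate.lean` applies). Theorems + computable checkers only: no named
fact, no axiom, nothing about `Ш` is asserted here.

THE CERTIFICATE. Let `E : y² + a₁xy + a₃y = x³ + a₂x² + a₄x + a₆` over `ℚ`, `p = 2d + 1` an odd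
prime and `H = X^d + h_{d-1}X^{d-1} + ⋯ + h₀ ∈ ℚ[X]` (the kernel polynomial of a rational
`p`-isogeny: its roots are the abscissae `x(P), x(2P), …, x(dP)` of a cyclic subgroup `ℤP ≤ E[p]`).
All arithmetic is in the finite `ℚ`-algebra `B = ℚ[X, Y]/(H(X), Y² + a₁XY + a₃Y − X³ − a₂X² − a₄X − a₆)`,
whose elements are written `u(X) + v(X)·Y` (pairs of coefficient lists); for ANY geometric point
`P = (x₁, y₁) ∈ E(ℚ̄)` with `H(x₁) = 0` the evaluation `X ↦ x₁, Y ↦ y₁` is a ring map `B → ℚ̄`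
(`evalB_mulB`, `congB_sound`). The certificate lists, for `k = 1, …, d`, the chord-tangent step
`P_{k+1} = P_k + P` carried out in `B` (Mathlib's affine addition formulas `slope`/`addX`/`addY`,
Silverman *AEC* III.2.3): an inverse `w_k` of the denominator (`2Y + a₁X + a₃` for the doubling,
`x_k − X` afterwards — so the formulas apply at EVERY root), the slope, and the reduced coordinates
`(x_{k+1}, y_{k+1})`, each congruence `lhs ≡ rhs (mod H)` being certified by an explicit quotient
(`lhs − rhs = q·H` exactly: the checker never divides). It then checks
(T) `P_{d+1} = −P_d` in `B`, whence `(2d+1)·P = O`, `P ≠ O`, so `P` has order `p` (`steps_sound`,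
`torsion_sound`); and (R) the identity `∏_{k=1}^{d} (T − x_k(X)) ≡ H(T) (mod H(X))` in `ℚ[X][T]`
(again with quotients), whence EVERY root of `H` in `ℚ̄` is `x(kP)` for some `1 ≤ k ≤ d`
(`roots_sound`). Consequently for `σ ∈ Γ_ℚ` the point `σP = (σx₁, σy₁)` has abscissa a root of `H`,
i.e. `x(σP) = x(kP)`, so `σP = ±kP ∈ ℤP` (`Affine.Y_eq_of_X_eq`): `ℤP` is a RATIONAL `p`-LINE
(`IsRationalLine`, Greenberg–Vatsal 2000 p. 4) and `E[p]` is reducible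
(`not_hasIrreducibleModPGaloisRep_of_isRationalLine`). THIS FILE: the computable checker `KerPoly.Cert.check`
(§1–§3) and the evaluation maps used to state its meaning (§3b); the semantics of the list arithmetic is
`Rank2ShaKerPolyCertEval.lean` and the main theorem `KerPoly.red_of_check` is `Rank2ShaKerPolyCertSound.lean`.

A census row then reads `hred` off `by decide +kernel` on `KerPoly.Cert.check c e p` exactly like the
other kernel tests of the tier kits (`Rank2ShaTierKitCM.irr_of_checkIrr`); the certificates are
generated (and independently re-verified in exact arithmetic) by ENGINE 3 from the kernel
polynomials of `HOME/engine/eng3-imc/out/alt/ALT_RED_W14_CGS_GV.tsv` (two implementations agree,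
kit j159928). References: J. H. Silverman, *The Arithmetic of Elliptic Curves*, GTM 106 (2009),
III.2.3 (group law), III.4.12–4.13 and Ex. 3.13 (isogeny kernels / Vélu) [SilvermanAEC2009];
R. Greenberg, V. Vatsal, Invent. Math. 142 (2000), p. 4 [GreenbergVatsal2000]; C. Wuthrich,
J. Algebraic Geom. 23 (2014), Thm. 16 (the consumer) [Wuthrich2014].
-/

set_option autoImplicit false

-- single-conjunct summit: `Summit.BirchSwinnertonDyer.BirchSwinnertonDyer.…` repeats the name by design
set_option linter.dupNamespace false

open WeierstrassCurve Polynomial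

namespace Summit.BirchSwinnertonDyer.BirchSwinnertonDyer.Rank2Sha

namespace KerPoly

/-! ### §1. Computable polynomial arithmetic over `ℚ` (coefficient lists, constant term first) -/

/-- Sum of two coefficient lists (the longer tail is kept). [folklore] -/
def addL : List ℚ → List ℚ → List ℚ
  | [], l => l
  | a :: l, [] => a :: l
  | a :: l₁, b :: l₂ => (a + b) :: addL l₁ l₂

/-- Scalar multiple of a coefficient list. [folklore] -/
def smulL (c : ℚ) : List ℚ → List ℚ
  | [] => []
  | a :: l => (c * a) :: smulL c l

/-- Negation of a coefficient list. [folklore] -/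
def negL : List ℚ → List ℚ
  | [] => []
  | a :: l => (-a) :: negL l

/-- Difference of coefficient lists. [folklore] -/
def subL (l₁ l₂ : List ℚ) : List ℚ :=
  addL l₁ (negL l₂)

/-- Product of coefficient lists (schoolbook, `(a + X·r)·m = a·m + X·(r·m)`). [folklore] -/
def mulL : List ℚ → List ℚ → List ℚ
  | [], _ => []
  | a :: l₁, l₂ => addL (smulL a l₂) (0 :: mulL l₁ l₂)

/-- All coefficients vanish. [folklore] -/
def isZeroL : List ℚ → Bool
  | [] => true
  | a :: l => decide (a = 0) && isZeroL l

/-! ### §2. The algebra `B = ℚ[X, Y]/(H, Weierstrass)`: elements `u(X) + v(X)·Y` as pairs -/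

/-- An element `u(X) + v(X)·Y` of `ℚ[X][Y]` of `Y`-degree `≤ 1`. [folklore] -/
abbrev B := List ℚ × List ℚ

/-- The five Weierstrass coefficients as rationals. [folklore] -/
structure Crv where
  /-- `a₁` -/
  a₁ : ℚ
  /-- `a₂` -/
  a₂ : ℚ
  /-- `a₃` -/
  a₃ : ℚ
  /-- `a₄` -/
  a₄ : ℚ
  /-- `a₆` -/
  a₆ : ℚ

/-- The coefficients of an integral model, cast to `ℚ`. [folklore] -/
def Crv.ofInt (e : WeierstrassCurve ℤ) : Crv :=
  ⟨e.a₁, e.a₂, e.a₃, e.a₄, e.a₆⟩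

/-- The coefficients of a rational model. [folklore] -/
def Crv.of (W : WeierstrassCurve ℚ) : Crv :=
  ⟨W.a₁, W.a₂, W.a₃, W.a₄, W.a₆⟩

/-- `F = X³ + a₂X² + a₄X + a₆` (so that `Y² = F + G·Y` on the curve). [folklore] -/
def Crv.F (A : Crv) : List ℚ :=
  [A.a₆, A.a₄, A.a₂, 1]

/-- `G = −a₃ − a₁X` (so that `Y² = F + G·Y` on the curve). [folklore] -/
def Crv.G (A : Crv) : List ℚ :=
  [-A.a₃, -A.a₁]

/-- Sum in `B`. [folklore] -/
def addB (b₁ b₂ : B) : B :=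
  (addL b₁.1 b₂.1, addL b₁.2 b₂.2)

/-- Negation in `B`. [folklore] -/
def negB (b : B) : B :=
  (negL b.1, negL b.2)

/-- Difference in `B`. [folklore] -/
def subB (b₁ b₂ : B) : B :=
  addB b₁ (negB b₂)

/-- Rational scalar multiple in `B`. [folklore] -/
def smulB (c : ℚ) (b : B) : B :=
  (smulL c b.1, smulL c b.2)

/-- Multiple of an element of `B` by a polynomial in `X` alone. [folklore] -/
def scaleB (q : List ℚ) (b : B) : B :=
  (mulL q b.1, mulL q b.2)

/-- The constant `c ∈ B`. [folklore] -/
def constB (c : ℚ) : B :=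
  ([c], [])

/-- `1 ∈ B`. [folklore] -/
def oneB : B :=
  ([1], [])

/-- The universal abscissa `X ∈ B`. [folklore] -/
def PX : B :=
  ([0, 1], [])

/-- The universal ordinate `Y ∈ B`. [folklore] -/
def PY : B :=
  ([], [1])

/-- Product in `ℚ[X][Y]` of two elements of `Y`-degree `≤ 1`, with `Y²` eliminated ONCE by the
Weierstrass relation `Y² = F + G·Y` (exact, no reduction modulo `H`). [folklore] -/
def mulB (A : Crv) (b₁ b₂ : B) : B :=
  (addL (mulL b₁.1 b₂.1) (mulL (mulL b₁.2 b₂.2) A.F),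
    addL (addL (mulL b₁.1 b₂.2) (mulL b₁.2 b₂.1)) (mulL (mulL b₁.2 b₂.2) A.G))

/-- Both components vanish. [folklore] -/
def isZeroB (b : B) : Bool :=
  isZeroL b.1 && isZeroL b.2

/-- The certified congruence `lhs ≡ rhs (mod H)`: `lhs − rhs − q·H = 0` EXACTLY in `ℚ[X][Y]`, the
quotient `q` being part of the certificate (the checker never divides). [folklore] -/
def congB (H : List ℚ) (lhs rhs q : B) : Bool :=
  isZeroB (subB (subB lhs rhs) (scaleB H q))

/-- The ordinate of `−(x, y)`: `−y − a₁x − a₃` (Mathlib `Affine.negY`), in `B`. [folklore] -/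
def negYB (A : Crv) (x y : B) : B :=
  subB (subB (negB y) (smulB A.a₁ x)) (constB A.a₃)

/-! ### §3. The certificate and its checker -/

/-- One chord-tangent step `P_{k+1} = P_k + P` in `B`: the inverse `w` of the denominator, the slope
`lam`, the coordinates `(x, y)` of `P_{k+1}` (all reduced modulo `H`), each with the quotient
certifying its defining congruence. [folklore] -/
structure Step where
  /-- inverse of the denominator (`2Y + a₁X + a₃`, resp. `x_k − X`) modulo `H` -/
  w : B
  /-- quotient for `w · den ≡ 1` -/
  qw : B
  /-- the slope -/
  lam : B
  /-- quotient for `num · w ≡ lam` -/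
  qlam : B
  /-- abscissa of `P_{k+1}` -/
  x : B
  /-- quotient for `addX ≡ x` -/
  qx : B
  /-- ordinate of `P_{k+1}` -/
  y : B
  /-- quotient for `addY ≡ y` -/
  qy : B

/-- A kernel-polynomial certificate: the lower coefficients `h = [h₀, …, h_{d-1}]` of the monic
`H = X^d + Σ hᵢXⁱ`, the `d` chord-tangent steps, and the quotients of the root identity
`∏ (T − x_k) ≡ H(T) (mod H(X))` (one polynomial in `X` per power of `T`). [folklore] -/
structure Cert where
  /-- lower coefficients of the monic kernel polynomial -/
  h : List ℚ
  /-- the steps `P ↦ 2P ↦ 3P ↦ ⋯ ↦ (d+1)P` -/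
  steps : List Step
  /-- quotients of the root identity, by power of `T` -/
  qs : List (List ℚ)

/-- The full coefficient list of `H = X^d + Σ hᵢXⁱ`. [folklore] -/
def Cert.H (c : Cert) : List ℚ :=
  c.h ++ [1]

/-- Verification of one step: with `den`/`num` the denominator/numerator of Mathlib's `slope` (the
tangent case `(3X² + 2a₂X + a₄ − a₁Y)/(2Y + a₁X + a₃)` for the first step `P + P`, the chord case
`(y_k − Y)/(x_k − X)` afterwards), check `w·den ≡ 1`, `num·w ≡ lam`,
`lam² + a₁·lam − a₂ − x_k − X ≡ x` (`Affine.addX`) and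
`−(lam·(x − x_k) + y_k) − a₁·x − a₃ ≡ y` (`Affine.addY`), all modulo `H`. [folklore] -/
def stepOK (A : Crv) (H : List ℚ) (first : Bool) (xk yk : B) (s : Step) : Bool :=
  let den : B := if first then ([A.a₃, A.a₁], [2]) else subB xk PX
  let num : B := if first then ([A.a₄, 2 * A.a₂, 3], [-A.a₁]) else subB yk PY
  congB H (mulB A s.w den) oneB s.qw &&
  congB H (mulB A num s.w) s.lam s.qlam &&
  congB H (subB (subB (subB (addB (mulB A s.lam s.lam) (smulB A.a₁ s.lam)) (constB A.a₂)) xk) PX)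
    s.x s.qx &&
  congB H (subB (subB (negB (addB (mulB A s.lam (subB s.x xk)) yk)) (smulB A.a₁ s.x)) (constB A.a₃))
    s.y s.qy

/-- Verification of the chain of steps starting from `(x_k, y_k)` (`first`: the first step is the
doubling `P + P`). [folklore] -/
def stepsOK (A : Crv) (H : List ℚ) : Bool → B → B → List Step → Bool
  | _, _, _, [] => true
  | first, xk, yk, s :: rest => stepOK A H first xk yk s && stepsOK A H false s.x s.y rest

/-- The torsion test (T): `P_{d+1} = −P_d`, i.e. `x_{d+1} = x_d` and `y_{d+1} = −y_d − a₁x_d − a₃`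
in `B` (on the list `pts = [P_1, …, P_{d+1}]`). [folklore] -/
def torsionOK (A : Crv) (pts : List (B × B)) (d : ℕ) : Bool :=
  match pts[d - 1]?, pts[d]? with
  | some a, some b => isZeroB (subB b.1 a.1) && isZeroB (subB b.2 (negYB A a.1 a.2))
  | _, _ => false

/-- Pointwise difference of `T`-coefficient lists (polynomials in `X`). [folklore] -/
def subLT : List (List ℚ) → List (List ℚ) → List (List ℚ)
  | [], l => l.map negL
  | a :: l, [] => a :: l
  | a :: l₁, b :: l₂ => subL a b :: subLT l₁ l₂

/-- Multiplication of a polynomial in `T` with coefficients in `ℚ[X]` by `T − u(X)`. [folklore] -/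
def mulTminus (u : List ℚ) (poly : List (List ℚ)) : List (List ℚ) :=
  subLT ([] :: poly) (poly.map (mulL u))

/-- `∏ (T − u(X))` over a list of polynomials `u`, as a polynomial in `T` over `ℚ[X]`. [folklore] -/
def prodT : List (List ℚ) → List (List ℚ)
  | [] => [[1]]
  | u :: us => mulTminus u (prodT us)

/-- Every `T`-coefficient is the certified multiple `q_j·H` of `H` (exactly). [folklore] -/
def allMulH (H : List ℚ) : List (List ℚ) → List (List ℚ) → Bool
  | [], [] => true
  | dj :: D, qj :: qs => isZeroL (subL dj (mulL qj H)) && allMulH H D qs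
  | _, _ => false

/-- The root test (R): `∏_{k ≤ d} (T − x_k(X)) − H(T)` is, coefficientwise in `T`, a certified
multiple of `H(X)`. [folklore] -/
def rootsOK (H : List ℚ) (us : List (List ℚ)) (qs : List (List ℚ)) : Bool :=
  allMulH H (subLT (prodT us) (H.map fun c => [c])) qs

/-- **The kernel-polynomial checker.** For an integral model `e`, an odd `p` and a certificate `c`
with `d` steps: `p = 2d + 1`, `deg H = |h| ≥ 1`, the chain of steps from `P = (X, Y)` verifies,
(T) `P_{d+1} = −P_d`, the abscissae `x_1, …, x_d` are `Y`-free, and (R) holds. [folklore] -/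
def Cert.check (c : Cert) (e : WeierstrassCurve ℤ) (p : ℕ) : Bool :=
  let A := Crv.ofInt e
  let d := c.steps.length
  let pts : List (B × B) := (PX, PY) :: c.steps.map fun s => (s.x, s.y)
  let xs : List B := (pts.take d).map Prod.fst
  decide (p = 2 * d + 1) && decide (1 ≤ c.h.length) &&
  stepsOK A c.H true PX PY c.steps &&
  torsionOK A pts d &&
  xs.all (fun b => isZeroL b.2) &&
  rootsOK c.H (xs.map Prod.fst) c.qs


/-! ### §3b. Evaluation maps (the MEANING of the lists; lemmas in `Rank2ShaKerPolyCertEval.lean`) -/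

section EvalDefs

variable {K : Type*} [CommRing K] [Algebra ℚ K]

/-- Evaluation of a coefficient list at `x` (Horner): `[c₀, c₁, …] ↦ Σ cᵢ xⁱ`. [folklore] -/
def evalL (x : K) : List ℚ → K
  | [] => 0
  | c :: l => algebraMap ℚ K c + x * evalL x l

/-- `evalL x [] = 0`. [folklore] -/
@[simp] theorem evalL_nil (x : K) : evalL x [] = 0 := rfl

/-- `evalL x (c :: l) = c + x · evalL x l`. [folklore] -/
@[simp] theorem evalL_cons (x : K) (c : ℚ) (l : List ℚ) :
    evalL x (c :: l) = algebraMap ℚ K c + x * evalL x l := rfl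

/-- Evaluation of `u(X) + v(X)·Y ∈ B` at `(x, y)`. [folklore] -/
def evalB (x y : K) (b : B) : K :=
  evalL x b.1 + evalL x b.2 * y

/-- Evaluation of a polynomial in `T` with coefficients in `ℚ[X]` at `(x, t)`. [folklore] -/
def evalLT (x t : K) : List (List ℚ) → K
  | [] => 0
  | d :: ds => evalL x d + t * evalLT x t ds

/-- `evalLT x t [] = 0`. [folklore] -/
@[simp] theorem evalLT_nil (x t : K) : evalLT x t [] = 0 := rfl

/-- `evalLT x t (d :: ds) = d(x) + t · evalLT x t ds`. [folklore] -/
@[simp] theorem evalLT_cons (x t : K) (d : List ℚ) (ds : List (List ℚ)) :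
    evalLT x t (d :: ds) = evalL x d + t * evalLT x t ds := rfl

end EvalDefs

/-- The polynomial `Σ cᵢ Xⁱ ∈ ℚ[X]` with coefficient list `l` (used only to produce a root of the
monic `H` in `ℚ̄`). [folklore] -/
noncomputable def toPoly : List ℚ → ℚ[X]
  | [] => 0
  | c :: l => C c + X * toPoly l

end KerPoly

end Summit.BirchSwinnertonDyer.BirchSwinnertonDyer.Rank2Sha
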